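import Mathlib
import Summits.AtomisticToContinuum.HydrodynamicLimit.Theorems.OneFlightGossipEngineSuperExponentialEnergyTailsDefsB
import Summits.AtomisticToContinuum.HydrodynamicLimit.Theorems.OneFlightGossipEngineSuperExponentialEnergyTailsGevreyInductionPrelim
import Summits.AtomisticToContinuum.HydrodynamicLimit.Theorems.OneFlightGossipEngineSuperExponentialEnergyTailsMaxPrinciple
import Summits.AtomisticToContinuum.HydrodynamicLimit.Theorems.OneFlightGossipEngineSuperExponentialEnergyTailsGevreyGain
import HarnessLib

/-!
# The abstract Gevrey induction `stub_gevreyInduction`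
# (line `Sketch`, crux `SuperExponentialEnergyTails`, stmt-AtomisticToContinuum-17701), stage 4/4

Pure real analysis over the hypothesis structure `MomentSystem` (support file `…SuperExponentialEnergyTailsDefsB`, §5):
the registered stub `stub_gevreyInduction : GevreyInduction` — every moment system with Povzner balance, Lyapunov
log-convexity, bounded energy and Gaussian initial class is of Gevrey class `m_{2k}(s) ≤ C Aᵏ k^{3k/2}` with
`C, A` depending on the constants `(k₁, q, K₁, K₂, C_G, C_SD, E₁, C₀, A₀)` ONLY (uniform in the horizon `t`, the
frequency scale `ν` and the truncation order `n`).

Proof (Bobylev 1997 / Desvillettes 1993 moment method, as an order-by-order maximum principle in the sharper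
factorial class `X_k = C Aᵏ (k!)^{3/2}`, then `(k!)^{3/2} ≤ k^{3k/2}`):
* orders `k < k₂`: the polynomial bounds `D k` of stage 2 (`gevreyPolynomialBounds`), absorbed by `A ≥ 1 + ∑_{i<k₂} |D i|`;
* orders `k ≥ k₂ (≥ k₁ ≥ 2)`, strong induction: maximum principle (`gevreyMaxPrinciple`, stage 2) at the level
  `X_k`.  Above `X_k` the balance integrand is `≤ 0` (`balance_integrand_nonpos`): the gain sum splits into the two
  TOP terms carrying the order `2k-1` (`top_term_fst_le`, `top_term_snd_le`: `≤ k C_G 2^q E² y` each, by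
  interpolation) and the LOWER terms, bounded by the inductive class through `m_{2i+1} ≤ √(X_i X_{i+1})`
  (`lower_prod_fst_le`, `lower_prod_snd_le`: `C(k,j) · product ≤ C² Aᵏ √A k^{3/4} (k!)^{3/2} / √C(k,j)`), summed
  with the combinatorial bound `∑ (1+min)^q/√C(k,j) ≤ σ` of stage 1 (`gain_sum_le`, stage 3); the loss is
  `≥ (K₁/2) y · y^{1/(2k)} - K₂ y` (`loss_lower`, stage 2) with `y^{1/(2k)} ≥ X_k^{1/(2k)} ≥ √A e^{-3/4} k^{3/4}`
  (`root_level_le`, stage 1).  With `Λ₀ = K₁ e^{-3/4}/8` the three thresholds `C_SD C_G C σ ≤ Λ₀ k` (`k ≥ k₂`),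
  `C_SD C_G 2^q E² ≤ Λ₀ √A`, `K₂ ≤ Λ₀ √A` (`A` large) make gain `+ K₂ y` at most `3 Λ₀ √A k^{3/4} y <` loss.

prover-line-stmt-AtomisticToContinuum-17701-0 (stub worker `stub_gevreyInduction`).
-/

noncomputable section

namespace Summit.AtomisticToContinuum.HydrodynamicLimit.Theorems.SuperExponentialEnergyTailsGevreyInduction

open scoped BigOperators
open MeasureTheory Set
open Summit.AtomisticToContinuum.HydrodynamicLimit.Theorems.SuperExponentialEnergyTailsLine (MomentSystem GevreyInduction)
open Summit.AtomisticToContinuum.HydrodynamicLimit.Theorems.SuperExponentialEnergyTailsGevreyInductionPrelim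
  (root_level_le min_cast_nonneg gevreyCombinatorialBound)
open Summit.AtomisticToContinuum.HydrodynamicLimit.Theorems.SuperExponentialEnergyTailsMaxPrinciple
  (gevreyMaxPrinciple loss_lower gevreyPolynomialBounds)
open Summit.AtomisticToContinuum.HydrodynamicLimit.Theorems.SuperExponentialEnergyTailsGevreyGain (gain_sum_le)

variable {t ν : ℝ} {n k₁ q : ℕ} {K₁ K₂ CG CSD E₁ C₀ A₀ : ℝ} {m : ℕ → ℝ → ℝ}

/-! ## §1 Negativity of the balance above the Gevrey level -/

/-- **The balance integrand is non-positive above the Gevrey level** (inductive step).  Let `k ≥ k₁`, the class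
`m_{2i} ≤ C Aⁱ (i!)^{3/2}` hold below `k` on `[0,t]`, and the thresholds
`C_SD C_G C σ ≤ Λ₀ k`, `C_SD C_G 2^q E² ≤ Λ₀ √A`, `K₂ ≤ Λ₀ √A` hold with `Λ₀ = K₁ e^{-3/4}/8`, `E = max E₁ 1`,
`∑_{0<j<k} w_j ≤ σ`.  Then at every `r ∈ [0,t]` with `C Aᵏ (k!)^{3/2} < m_{2k}(r)` the Povzner balance integrand
is `≤ 0`: gain `≤ Λ₀√A k^{3/4} (y + X_k)`, `K₂ y ≤ Λ₀ √A k^{3/4} y`, loss `≥ 4 Λ₀ √A k^{3/4} y`. [folklore] -/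
theorem balance_integrand_nonpos (hM : MomentSystem t ν n k₁ q K₁ K₂ CG CSD E₁ C₀ A₀ m) (hk₁ : 2 ≤ k₁)
    (hK₁ : 0 < K₁) (hK₂ : 0 ≤ K₂) (hCG : 0 ≤ CG) (hCSD : 0 ≤ CSD) (hCSDk : 2 * CSD ≤ (k₁ : ℝ) + 1)
    {C A σ : ℝ} (hC : 1 ≤ C) (hA : 1 ≤ A) {k : ℕ} (hk : k₁ ≤ k)
    (hσ : ∑ j ∈ Finset.Ioo 0 k, (1 + (min j (k - j) : ℝ)) ^ q / Real.sqrt (k.choose j) ≤ σ)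
    (hT1 : CSD * CG * C * σ ≤ K₁ / 8 * Real.exp (-3 / 4) * k)
    (hT2 : CSD * CG * 2 ^ q * max E₁ 1 ^ 2 ≤ K₁ / 8 * Real.exp (-3 / 4) * Real.sqrt A)
    (hT3 : K₂ ≤ K₁ / 8 * Real.exp (-3 / 4) * Real.sqrt A)
    (IH : ∀ i < k, ∀ s ∈ Set.Icc 0 t, m (2 * i) s ≤ C * A ^ i * (i.factorial : ℝ) ^ ((3 : ℝ) / 2))
    {r : ℝ} (hr : r ∈ Set.Icc 0 t) (hy : C * A ^ k * (k.factorial : ℝ) ^ ((3 : ℝ) / 2) < m (2 * k) r) :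
    (CSD / ((k : ℝ) + 1) / 2) *
          ∑ j ∈ Finset.Ioo 0 k, (k.choose j : ℝ) * (CG * (1 + (min j (k - j) : ℝ)) ^ q) *
            (m (2 * j + 1) r * m (2 * (k - j)) r + m (2 * j) r * m (2 * (k - j) + 1) r)
        - (1 - CSD / ((k : ℝ) + 1)) * (K₁ * m (2 * k + 1) r - K₂ * m (2 * k) r) ≤ 0 := by
  have hk2 : 2 ≤ k := hk₁.trans hk
  have hkr : (1 : ℝ) ≤ k := by exact_mod_cast (show 1 ≤ k by omega)
  have hk0 : (0 : ℝ) < (k : ℝ) + 1 := by positivity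
  set y : ℝ := m (2 * k) r with hydef
  set Xk : ℝ := C * A ^ k * (k.factorial : ℝ) ^ ((3 : ℝ) / 2) with hXk
  set Λ₀ : ℝ := K₁ / 8 * Real.exp (-3 / 4) with hΛ₀
  set P : ℝ := Λ₀ * Real.sqrt A * (k : ℝ) ^ ((3 : ℝ) / 4) with hP
  have hA0 : 0 ≤ A := zero_le_one.trans hA
  have hΛ₀0 : 0 < Λ₀ := by positivity
  have hP0 : 0 ≤ P := by positivity
  have hF1 : 1 ≤ (k.factorial : ℝ) ^ ((3 : ℝ) / 2) :=
    Real.one_le_rpow (by exact_mod_cast Nat.succ_le_of_lt k.factorial_pos) (by norm_num)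
  have hXk1 : 1 ≤ Xk := by
    have h1 : (1 : ℝ) ≤ C * A ^ k := one_le_mul_of_one_le_of_one_le hC (one_le_pow₀ hA)
    exact one_le_mul_of_one_le_of_one_le h1 hF1
  have hXk0 : 0 ≤ Xk := zero_le_one.trans hXk1
  have hy1 : 1 ≤ y := hXk1.trans hy.le
  have hy0 : 0 ≤ y := zero_le_one.trans hy1
  have hW : max 1 y = y := max_eq_right hy1
  have hk34 : 1 ≤ (k : ℝ) ^ ((3 : ℝ) / 4) := Real.one_le_rpow hkr (by norm_num)
  -- gain
  have hG := gain_sum_le hM hCG (zero_le_one.trans hC) hA0 hk2 IH hr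
  rw [hW] at hG
  have hγ0 : 0 ≤ CSD / ((k : ℝ) + 1) := div_nonneg hCSD hk0.le
  have hγk : CSD / ((k : ℝ) + 1) * k ≤ CSD := by
    rw [div_mul_eq_mul_div, div_le_iff₀ hk0]
    nlinarith
  -- (i) the top terms: γ k C_G 2^q E² y ≤ P y
  have htop : CSD / ((k : ℝ) + 1) * ((k : ℝ) * CG * 2 ^ q * (max E₁ 1 ^ 2 * y)) ≤ P * y := by
    have h1 : CSD / ((k : ℝ) + 1) * ((k : ℝ) * CG * 2 ^ q * (max E₁ 1 ^ 2 * y))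
        = (CSD / ((k : ℝ) + 1) * k) * (CG * 2 ^ q * max E₁ 1 ^ 2) * y := by ring
    have h2 : (CSD / ((k : ℝ) + 1) * k) * (CG * 2 ^ q * max E₁ 1 ^ 2) ≤ CSD * (CG * 2 ^ q * max E₁ 1 ^ 2) :=
      mul_le_mul_of_nonneg_right hγk (by positivity)
    have h3 : CSD * (CG * 2 ^ q * max E₁ 1 ^ 2) ≤ Λ₀ * Real.sqrt A := by
      have := hT2
      linarith [this]
    have h4 : Λ₀ * Real.sqrt A ≤ P := by
      rw [hP]
      exact le_mul_of_one_le_right (by positivity) hk34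
    rw [h1]
    exact mul_le_mul_of_nonneg_right (h2.trans (h3.trans h4)) hy0
  -- (ii) the lower terms: γ C_G Q ∑w ≤ P Xk
  have hlow : CSD / ((k : ℝ) + 1) * (CG * (C ^ 2 * A ^ k * Real.sqrt A * (k : ℝ) ^ ((3 : ℝ) / 4) *
        (k.factorial : ℝ) ^ ((3 : ℝ) / 2)) *
        ∑ j ∈ Finset.Ioo 0 k, (1 + (min j (k - j) : ℝ)) ^ q / Real.sqrt (k.choose j)) ≤ P * Xk := by
    have hσ0 : 0 ≤ ∑ j ∈ Finset.Ioo 0 k, (1 + (min j (k - j) : ℝ)) ^ q / Real.sqrt (k.choose j) := by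
      refine Finset.sum_nonneg fun j hj => ?_
      rw [Finset.mem_Ioo] at hj
      have := min_cast_nonneg hj.2.le
      positivity
    calc CSD / ((k : ℝ) + 1) * (CG * (C ^ 2 * A ^ k * Real.sqrt A * (k : ℝ) ^ ((3 : ℝ) / 4) *
          (k.factorial : ℝ) ^ ((3 : ℝ) / 2)) *
          ∑ j ∈ Finset.Ioo 0 k, (1 + (min j (k - j) : ℝ)) ^ q / Real.sqrt (k.choose j))
          ≤ CSD / ((k : ℝ) + 1) * (CG * (C ^ 2 * A ^ k * Real.sqrt A * (k : ℝ) ^ ((3 : ℝ) / 4) *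
              (k.factorial : ℝ) ^ ((3 : ℝ) / 2)) * σ) := by
            gcongr
      _ = (CSD * CG * C * σ) / ((k : ℝ) + 1) * (Real.sqrt A * (k : ℝ) ^ ((3 : ℝ) / 4) * Xk) := by
            rw [hXk]
            ring
      _ ≤ (K₁ / 8 * Real.exp (-3 / 4) * k) / ((k : ℝ) + 1) * (Real.sqrt A * (k : ℝ) ^ ((3 : ℝ) / 4) * Xk) := by
            gcongr
      _ ≤ (K₁ / 8 * Real.exp (-3 / 4)) * (Real.sqrt A * (k : ℝ) ^ ((3 : ℝ) / 4) * Xk) := by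
            apply mul_le_mul_of_nonneg_right _ (by positivity)
            rw [div_le_iff₀ hk0]
            nlinarith [hΛ₀0]
      _ = P * Xk := by
            rw [hP, hΛ₀]
            ring
  -- (iii) K₂ y ≤ P y
  have hK₂P : K₂ * y ≤ P * y := by
    apply mul_le_mul_of_nonneg_right _ hy0
    calc K₂ ≤ Λ₀ * Real.sqrt A := hT3
      _ ≤ P := le_mul_of_one_le_right (by positivity) hk34
  -- (iv) loss ≥ 4 P y - K₂ y
  have hL := loss_lower hM hk₁ hK₁ hK₂ hCSD hCSDk hk hr
  have hroot := root_level_le hC hA0 (by omega : 1 ≤ k) hy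
  have hloss4 : 4 * P * y ≤ K₁ / 2 * (y * y ^ (1 / (2 * (k : ℝ)))) := by
    have h1 : y * (Real.sqrt A * (Real.exp (-3 / 4) * (k : ℝ) ^ ((3 : ℝ) / 4))) ≤ y * y ^ (1 / (2 * (k : ℝ))) :=
      mul_le_mul_of_nonneg_left hroot hy0
    have h2 : 4 * P * y = K₁ / 2 * (y * (Real.sqrt A * (Real.exp (-3 / 4) * (k : ℝ) ^ ((3 : ℝ) / 4)))) := by
      rw [hP, hΛ₀]
      ring
    rw [h2]
    exact mul_le_mul_of_nonneg_left h1 (by positivity)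
  -- assemble
  have hgain : CSD / ((k : ℝ) + 1) / 2 *
        ∑ j ∈ Finset.Ioo 0 k, (k.choose j : ℝ) * (CG * (1 + (min j (k - j) : ℝ)) ^ q) *
          (m (2 * j + 1) r * m (2 * (k - j)) r + m (2 * j) r * m (2 * (k - j) + 1) r)
      ≤ P * y + P * Xk := by
    have hγ2 : 0 ≤ CSD / ((k : ℝ) + 1) / 2 := by positivity
    calc _ ≤ CSD / ((k : ℝ) + 1) / 2 * (2 * ((k : ℝ) * CG * 2 ^ q * (max E₁ 1 ^ 2 * y))
          + 2 * (CG * (C ^ 2 * A ^ k * Real.sqrt A * (k : ℝ) ^ ((3 : ℝ) / 4) * (k.factorial : ℝ) ^ ((3 : ℝ) / 2)) *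
            ∑ j ∈ Finset.Ioo 0 k, (1 + (min j (k - j) : ℝ)) ^ q / Real.sqrt (k.choose j))) :=
            mul_le_mul_of_nonneg_left hG hγ2
      _ = CSD / ((k : ℝ) + 1) * ((k : ℝ) * CG * 2 ^ q * (max E₁ 1 ^ 2 * y))
          + CSD / ((k : ℝ) + 1) * (CG * (C ^ 2 * A ^ k * Real.sqrt A * (k : ℝ) ^ ((3 : ℝ) / 4) *
            (k.factorial : ℝ) ^ ((3 : ℝ) / 2)) *
            ∑ j ∈ Finset.Ioo 0 k, (1 + (min j (k - j) : ℝ)) ^ q / Real.sqrt (k.choose j)) := by ring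
      _ ≤ P * y + P * Xk := add_le_add htop hlow
  have hPX : P * Xk ≤ P * y := mul_le_mul_of_nonneg_left hy.le hP0
  have hPy : 0 ≤ P * y := mul_nonneg hP0 hy0
  linarith [hgain, hL, hloss4, hK₂P, hPX, hPy]

/-! ## §2 The induction (registered stub `stub_gevreyInduction`) -/

/-- **The abstract Gevrey induction** (registered stub `stub_gevreyInduction` of line `Sketch`, crux
`SuperExponentialEnergyTails`): `GevreyInduction` holds — for admissible constants there are `C, A > 0` depending on
`(k₁, q, K₁, K₂, C_G, C_SD, E₁, C₀, A₀)` only such that every `MomentSystem t ν n k₁ q … m` with `ν > 0`, `k₁ ≤ n`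
has `m_{2k}(s) ≤ C Aᵏ k^{3k/2}` for all `k ≤ n`, `s ∈ [0,t]`.  Choices: `C = max C₀ 1`, `Λ₀ = K₁ e^{-3/4}/8`,
`k₂ = max k₁ ⌈C_SD C_G C σ/Λ₀⌉₊`, `A = max (max A₀ (1 + ∑_{i<k₂} |D i|)) (max (C_SD C_G 2^q E²/Λ₀)² (K₂/Λ₀)²)`
with `D` from `gevreyPolynomialBounds` and `σ` from `gevreyCombinatorialBound`; strong induction on
`k` in the class `C Aᵏ (k!)^{3/2}` (`gevreyMaxPrinciple` + `balance_integrand_nonpos` for `k ≥ k₂`), and finally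
`(k!)^{3/2} ≤ (kᵏ)^{3/2} = k^{3k/2}`. [folklore] -/
theorem stub_gevreyInduction : GevreyInduction := by
  intro k₁ q K₁ K₂ CG CSD E₁ C₀ A₀ hk₁ hK₁ hK₂ hCG hCSD hCSDk _hE₁ hC₀ hA₀
  obtain ⟨D, hD⟩ := gevreyPolynomialBounds k₁ q K₁ K₂ CG CSD E₁ C₀ A₀ hk₁ hK₁ hK₂ hCG.le hCSD.le hCSDk
  obtain ⟨σ, hσ0, hσ⟩ := gevreyCombinatorialBound q
  set C : ℝ := max C₀ 1 with hC
  set Λ₀ : ℝ := K₁ / 8 * Real.exp (-3 / 4) with hΛ₀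
  have hΛ₀0 : 0 < Λ₀ := by positivity
  set k₂ : ℕ := max k₁ ⌈CSD * CG * C * σ / Λ₀⌉₊ with hk₂
  set S : ℝ := ∑ i ∈ Finset.range k₂, |D i| with hS
  set A : ℝ := max (max A₀ (1 + S)) (max ((CSD * CG * 2 ^ q * max E₁ 1 ^ 2 / Λ₀) ^ 2) ((K₂ / Λ₀) ^ 2))
    with hA
  have hC1 : 1 ≤ C := le_max_right _ _
  have hCC₀ : C₀ ≤ C := le_max_left _ _
  have hS0 : 0 ≤ S := Finset.sum_nonneg fun i _ => abs_nonneg _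
  have hA1S : 1 + S ≤ A := le_trans (le_max_right _ _) (le_max_left _ _)
  have hA1 : 1 ≤ A := by linarith
  have hA0 : 0 < A := by linarith
  have hAA₀ : A₀ ≤ A := le_trans (le_max_left _ _) (le_max_left _ _)
  -- the thresholds on A
  have hT2 : CSD * CG * 2 ^ q * max E₁ 1 ^ 2 ≤ Λ₀ * Real.sqrt A := by
    have h1 : (CSD * CG * 2 ^ q * max E₁ 1 ^ 2 / Λ₀) ^ 2 ≤ A := le_trans (le_max_left _ _) (le_max_right _ _)
    have h2 : CSD * CG * 2 ^ q * max E₁ 1 ^ 2 / Λ₀ ≤ Real.sqrt A := by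
      rw [← Real.sqrt_sq (by positivity : 0 ≤ CSD * CG * 2 ^ q * max E₁ 1 ^ 2 / Λ₀)]
      exact Real.sqrt_le_sqrt h1
    rw [div_le_iff₀ hΛ₀0] at h2
    linarith
  have hT3 : K₂ ≤ Λ₀ * Real.sqrt A := by
    have h1 : (K₂ / Λ₀) ^ 2 ≤ A := le_trans (le_max_right _ _) (le_max_right _ _)
    have h2 : K₂ / Λ₀ ≤ Real.sqrt A := by
      rw [← Real.sqrt_sq (by positivity : 0 ≤ K₂ / Λ₀)]
      exact Real.sqrt_le_sqrt h1
    rw [div_le_iff₀ hΛ₀0] at h2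
    linarith
  refine ⟨C, by positivity, A, hA0, ?_⟩
  intro t ν n m hν hn hM
  -- the sharper factorial class, by strong induction on the order
  have claim : ∀ k, k ≤ n → ∀ s ∈ Set.Icc 0 t, m (2 * k) s ≤ C * A ^ k * (k.factorial : ℝ) ^ ((3 : ℝ) / 2) := by
    intro k
    refine Nat.strong_induction_on k ?_
    intro k ih hkn s hs
    have hF1 : 1 ≤ (k.factorial : ℝ) ^ ((3 : ℝ) / 2) :=
      Real.one_le_rpow (by exact_mod_cast Nat.succ_le_of_lt k.factorial_pos) (by norm_num)
    rcases lt_or_ge k k₂ with hlt | hge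
    · -- orders below k₂: the polynomial bounds, absorbed by A
      rcases Nat.eq_zero_or_pos k with h0 | hkpos
      · subst h0
        calc m (2 * 0) s = m 0 s := by norm_num
          _ ≤ 1 := hM.mass_le s hs
          _ ≤ C * A ^ 0 * ((0 : ℕ).factorial : ℝ) ^ ((3 : ℝ) / 2) := by simp [hC1]
      · have h1 : m (2 * k) s ≤ D k := hD t ν n m hν hn hM k hkn s hs
        have h2 : D k ≤ S := by
          calc D k ≤ |D k| := le_abs_self _
            _ ≤ S := Finset.single_le_sum (f := fun i => |D i|) (fun i _ => abs_nonneg _)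
                (Finset.mem_range.mpr hlt)
        have h3 : S ≤ A ^ k := by
          calc S ≤ A := by linarith
            _ ≤ A ^ k := le_self_pow₀ hA1 (by omega)
        have h4 : A ^ k ≤ C * A ^ k * (k.factorial : ℝ) ^ ((3 : ℝ) / 2) := by
          have h0 : 0 ≤ A ^ k := by positivity
          calc A ^ k = 1 * A ^ k * 1 := by ring
            _ ≤ C * A ^ k * (k.factorial : ℝ) ^ ((3 : ℝ) / 2) := by gcongr
        linarith
    · -- orders k ≥ k₂: maximum principle at the Gevrey level
      have hk₁k : k₁ ≤ k := le_trans (le_max_left _ _) hge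
      have hk1 : 1 ≤ k := by omega
      have hT1 : CSD * CG * C * σ ≤ Λ₀ * k := by
        have h1 : (⌈CSD * CG * C * σ / Λ₀⌉₊ : ℝ) ≤ k := by
          exact_mod_cast le_trans (le_max_right _ _) hge
        have h2 : CSD * CG * C * σ / Λ₀ ≤ k := le_trans (Nat.le_ceil _) h1
        rw [div_le_iff₀ hΛ₀0] at h2
        linarith
      refine gevreyMaxPrinciple t ν (C * A ^ k * (k.factorial : ℝ) ^ ((3 : ℝ) / 2)) (m (2 * k)) _ hν.le
        (hM.continuousOn _) ?_ ?_ (hM.balance k hk₁k hkn) s hs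
      · -- initial class
        calc m (2 * k) 0 ≤ C₀ * A₀ ^ k * (k.factorial : ℝ) := hM.initial k
          _ ≤ C * A ^ k * (k.factorial : ℝ) ^ ((3 : ℝ) / 2) := by
              have h1 : A₀ ^ k ≤ A ^ k := pow_le_pow_left₀ hA₀.le hAA₀ k
              have h2 : (k.factorial : ℝ) ≤ (k.factorial : ℝ) ^ ((3 : ℝ) / 2) := by
                have hf : (1 : ℝ) ≤ k.factorial := by exact_mod_cast Nat.succ_le_of_lt k.factorial_pos
                calc (k.factorial : ℝ) = (k.factorial : ℝ) ^ (1 : ℝ) := (Real.rpow_one _).symm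
                  _ ≤ (k.factorial : ℝ) ^ ((3 : ℝ) / 2) := Real.rpow_le_rpow_of_exponent_le hf (by norm_num)
              have h3 : (0 : ℝ) ≤ k.factorial := by positivity
              exact mul_le_mul (mul_le_mul hCC₀ h1 (by positivity) (by positivity)) h2 h3 (by positivity)
      · intro r hr hlt
        exact balance_integrand_nonpos hM hk₁ hK₁ hK₂ hCG.le hCSD.le hCSDk hC1 hA1 hk₁k (hσ k) hT1 hT2 hT3
          (fun i hi s' hs' => ih i hi (by omega) s' hs') hr hlt
  -- conclusion: (k!)^{3/2} ≤ k^{3k/2}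
  intro k hkn s hs
  have hfac : (k.factorial : ℝ) ^ ((3 : ℝ) / 2) ≤ (k : ℝ) ^ ((3 : ℝ) / 2 * k) := by
    have h1 : (k.factorial : ℝ) ≤ (k : ℝ) ^ k := by exact_mod_cast Nat.factorial_le_pow k
    calc (k.factorial : ℝ) ^ ((3 : ℝ) / 2) ≤ ((k : ℝ) ^ k) ^ ((3 : ℝ) / 2) :=
          Real.rpow_le_rpow (by positivity) h1 (by norm_num)
      _ = (k : ℝ) ^ ((3 : ℝ) / 2 * k) := by
          rw [← Real.rpow_natCast_mul (Nat.cast_nonneg k), mul_comm]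
  calc m (2 * k) s ≤ C * A ^ k * (k.factorial : ℝ) ^ ((3 : ℝ) / 2) := claim k hkn s hs
    _ ≤ C * A ^ k * (k : ℝ) ^ ((3 : ℝ) / 2 * k) := by gcongr

end Summit.AtomisticToContinuum.HydrodynamicLimit.Theorems.SuperExponentialEnergyTailsGevreyInduction

end
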